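import Summits.ResolutionOfSingularities.ResolutionOfSingularities.Theorems.FrobeniusClosingSteerRegularOrderProduct
import Mathlib.FieldTheory.Perfect
import Mathlib.FieldTheory.Minpoly.Field
import Mathlib.RingTheory.UniqueFactorizationDomain.Multiplicity
import Mathlib.Algebra.Polynomial.Degree.Domain
import HarnessLib

/-!
# Crux `Steer` (stmt-ResolutionOfSingularities-16345), chain W4.1, E-ROW row 9 (R3) `EvenResidueLettersHeavyTwoN`, brick F2:
# a polynomial of degree `< e` with coefficients killed by a derivation `D`, evaluated at `θ` with `D θ` a unit, has ORDER `< e`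
# in a regular local ring (`C(θ) ∉ 𝔫^e`) — over a PERFECT coefficient field

OURS (campaign `res-hironaka`, rung L ★L-G4, slot W4.1; seat res-L0-w41-stub-3 g8, res-L0-w41-plan-1 RULING 266 (e); route = res-L0-w41-idea-2
`g13/R3-PROOF-MAP.md` eab63904c0a3ca30 §3 «`m ≤ deg C`: `𝔫 ∩ κ[T] = (q)`, `q` irreducible and SEPARABLE (κ perfect), `ord q(T) = 1` by `∂`»; here `q` is the
minimal polynomial of the residue `θ̄` over `κ` and no chart is needed; replaces the role of no printed item; NOT a statement of the manuscript under review
[claim: Hironaka2017, status: under-review]; AI-produced, weaker than expert review). Theses-free, definition-free.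

ARGUMENT. `κ' = S/𝔫` is a `κ`-algebra through `φ`; if the residue `θ̄` is transcendental over `κ`, `C(θ)` is a unit. Else `q = minpoly_κ θ̄` is irreducible,
hence separable (`κ` perfect): `a·q + b·q' = 1`. Write `C = q^m · C₁` with `q ∤ C₁` (`WfDvdMonoid.max_power_factor`); then `C₁(θ̄) ≠ 0` (minimality), so
`C₁(θ)` is a unit; `q(θ) ∈ 𝔫` and `q'(θ)` is a unit (Bezout read modulo `𝔫`), and `D (q(θ)) = q'(θ)·Dθ` is a unit, so `q(θ) ∉ 𝔫²` (a derivation maps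
`𝔫²` into `𝔫`); by `RegularOrder.not_mem_pow_succ_mul`, `q(θ)^m · unit ∉ 𝔫^(m+1) ⊇ 𝔫^e` since `m ≤ m·deg q ≤ deg C < e`.

* `SeparableEvalOrder.derivation_eval₂` — chain rule `D (C(θ)) = C'(θ) · D θ` when `D` kills the coefficients;
* `SeparableEvalOrder.pow_mul_unit_not_mem_pow` — `q ∉ 𝔫², u` a unit ⟹ `q^m · u ∉ 𝔫^(m+1)` in a regular local ring;
* `SeparableEvalOrder.eval₂_not_mem_pow` — **the brick**. [cite: Matsumura1987, Thm. 17.10] [folklore]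
-/

noncomputable section

set_option linter.dupNamespace false

open IsLocalRing Polynomial

namespace Summit.ResolutionOfSingularities.ResolutionOfSingularities.Theorems.SwitchingDichotomy.SeparableEvalOrder

/-- **Chain rule**: if a derivation `D` kills the image of `φ`, then `D (C(θ)) = C'(θ) · D θ` for every polynomial `C` over the source of `φ`. [folklore] -/
theorem derivation_eval₂ {κ S : Type} [CommRing κ] [CommRing S] (φ : κ →+* S) (D : Derivation ℤ S S) (hDφ : ∀ a, D (φ a) = 0) (θ : S)
    (C : Polynomial κ) : D (C.eval₂ φ θ) = (derivative C).eval₂ φ θ * D θ := by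
  induction C using Polynomial.induction_on' with
  | add p q hp hq => rw [eval₂_add, map_add, hp, hq, derivative_add, eval₂_add, add_mul]
  | monomial n a =>
    rw [eval₂_monomial, derivative_monomial, eval₂_monomial, Derivation.leibniz, hDφ, smul_zero, add_zero, smul_eq_mul]
    cases n with
    | zero => simp
    | succ n =>
      rw [Derivation.leibniz_pow, Nat.add_sub_cancel, map_mul, map_natCast, smul_eq_mul]
      push_cast
      ring

/-- In a regular local ring, `q ∉ 𝔫²` and `u` a unit give `q^m · u ∉ 𝔫^(m+1)`. [cite: Matsumura1987, Thm. 17.10] [folklore] -/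
theorem pow_mul_unit_not_mem_pow {S : Type} [CommRing S] [IsRegularLocalRing S] {q u : S} (hq : q ∉ maximalIdeal S ^ 2) (hu : IsUnit u)
    (m : ℕ) : q ^ m * u ∉ maximalIdeal S ^ (m + 1) := by
  have hu' : u ∉ maximalIdeal S ^ (0 + 1) := by
    rw [zero_add, pow_one]
    exact fun h => (IsLocalRing.mem_maximalIdeal u).mp h hu
  induction m with
  | zero => rw [pow_zero, one_mul]; exact hu'
  | succ m ih =>
    have h := RegularOrder.not_mem_pow_succ_mul (i := 1) (j := m) hq ih
    have heq : q ^ (m + 1) * u = q * (q ^ m * u) := by ring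
    rw [heq, show m + 1 + 1 = 1 + m + 1 by ring]
    exact h

/-- **The brick.** `S` regular local, `φ : κ → S` from a PERFECT field, `D ∈ Der_ℤ(S)` killing `φ(κ)` with `D θ` a unit, `C ∈ κ[T]` non-zero of degree `< e`
⟹ `C(θ) ∉ 𝔫^e`. [cite: Matsumura1987, Thm. 17.10] [folklore] -/
theorem eval₂_not_mem_pow {κ S : Type} [Field κ] [PerfectField κ] [CommRing S] [IsRegularLocalRing S] (φ : κ →+* S) (D : Derivation ℤ S S)
    (hDφ : ∀ a, D (φ a) = 0) (θ : S) (hDθ : IsUnit (D θ)) (C : Polynomial κ) (hC : C ≠ 0) {e : ℕ} (hdeg : C.natDegree < e) :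
    C.eval₂ φ θ ∉ maximalIdeal S ^ e := by
  classical
  -- the residue field as a `κ`-algebra, and the residue `θ̄`
  letI : Algebra κ (ResidueField S) := ((residue S).comp φ).toAlgebra
  have halg : ∀ P : Polynomial κ, residue S (P.eval₂ φ θ) = aeval (residue S θ) P := fun P => by
    rw [hom_eval₂, aeval_def]; rfl
  -- a unit is not in `𝔫^e` for `e ≥ 1`
  have hunit : ∀ {u : S}, IsUnit u → u ∉ maximalIdeal S ^ e := fun {u} hu hmem => by
    have h1 : u ∈ maximalIdeal S := Ideal.pow_le_self (by omega) hmem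
    exact (IsLocalRing.mem_maximalIdeal u).mp h1 hu
  have hunit_of_res : ∀ {P : Polynomial κ}, aeval (residue S θ) P ≠ 0 → IsUnit (P.eval₂ φ θ) := fun {P} hP => by
    by_contra h
    exact hP (by rw [← halg, (residue_eq_zero_iff _).mpr ((IsLocalRing.mem_maximalIdeal _).mpr h)])
  by_cases hint : IsIntegral κ (residue S θ)
  · -- `q = minpoly`, separable; `C = q^m · C₁`, `q ∤ C₁`
    set q := minpoly κ (residue S θ) with hq
    have hqirr : Irreducible q := minpoly.irreducible hint
    obtain ⟨m, C₁, hC₁, hCq⟩ := WfDvdMonoid.max_power_factor hC hqirr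
    -- `C₁(θ)` is a unit
    have hC₁0 : aeval (residue S θ) C₁ ≠ 0 := fun h0 => hC₁ (minpoly.dvd κ _ h0)
    have hC₁u : IsUnit (C₁.eval₂ φ θ) := hunit_of_res hC₁0
    -- `q(θ) ∉ 𝔫²`: `D (q(θ)) = q'(θ) · Dθ` is a unit since `q` is separable and `q(θ) ∈ 𝔫`
    have hsep : q.Separable := PerfectField.separable_of_irreducible hqirr
    obtain ⟨a, b, hab⟩ := hsep
    have hqθ : q.eval₂ φ θ ∈ maximalIdeal S := by
      rw [← residue_eq_zero_iff, halg, hq, minpoly.aeval]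
    have hq'u : IsUnit ((derivative q).eval₂ φ θ) := by
      have h1 : (a * q + b * derivative q).eval₂ φ θ = 1 := by rw [hab, eval₂_one]
      rw [eval₂_add, eval₂_mul, eval₂_mul] at h1
      -- `b(θ) q'(θ) = 1 − a(θ) q(θ)` is a unit
      have h2 : IsUnit (b.eval₂ φ θ * (derivative q).eval₂ φ θ) := by
        by_contra hnu
        have hm : b.eval₂ φ θ * (derivative q).eval₂ φ θ ∈ maximalIdeal S := (IsLocalRing.mem_maximalIdeal _).mpr hnu
        have : (1 : S) ∈ maximalIdeal S := by
          rw [← h1]; exact Ideal.add_mem _ (Ideal.mul_mem_left _ _ hqθ) hm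
        exact (IsLocalRing.mem_maximalIdeal _).mp this isUnit_one
      exact isUnit_of_mul_isUnit_right h2
    have hq2 : q.eval₂ φ θ ∉ maximalIdeal S ^ 2 := by
      intro h2
      have hD : D (q.eval₂ φ θ) ∈ maximalIdeal S ^ 1 := Derivation.apply_mem_pow_of_mem_pow_succ D (maximalIdeal S) 1 h2
      rw [pow_one, derivation_eval₂ φ D hDφ θ q] at hD
      exact (IsLocalRing.mem_maximalIdeal _).mp hD (hq'u.mul hDθ)
    -- `m ≤ deg C < e`
    have hm : m + 1 ≤ e := by
      have hC₁ne : C₁ ≠ 0 := by rintro rfl; exact hC (by rw [hCq, mul_zero])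
      have hdegq : 1 ≤ q.natDegree := minpoly.natDegree_pos hint
      have h1 : (q ^ m).natDegree ≤ C.natDegree := natDegree_le_of_dvd ⟨C₁, hCq⟩ hC
      rw [natDegree_pow] at h1
      nlinarith
    -- conclude
    intro hmem
    have hmem' : q.eval₂ φ θ ^ m * C₁.eval₂ φ θ ∈ maximalIdeal S ^ (m + 1) := by
      have : C.eval₂ φ θ = q.eval₂ φ θ ^ m * C₁.eval₂ φ θ := by rw [hCq, eval₂_mul, eval₂_pow]
      rw [← this]
      exact Ideal.pow_le_pow_right hm hmem
    exact pow_mul_unit_not_mem_pow hq2 hC₁u m hmem'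
  · -- transcendental residue: `C(θ̄) ≠ 0`, so `C(θ)` is a unit
    have hC0 : aeval (residue S θ) C ≠ 0 := fun h0 => hint (IsAlgebraic.isIntegral ⟨C, hC, h0⟩)
    exact hunit (hunit_of_res hC0)

end Summit.ResolutionOfSingularities.ResolutionOfSingularities.Theorems.SwitchingDichotomy.SeparableEvalOrder

end
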